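import Mathlib
import Summits.MatrixMultiplication.MatrixMultiplication.Theses.FidelityWitnesses
import Summits.MatrixMultiplication.MatrixMultiplication.Theorems.FidelityWitnessesFidelityGapTwoSixConeClosure
import Literature.Computability.AlgebraicComplexity.AsymptoticRankZariskiClosedProofs
import Literature.Computability.AlgebraicComplexity.BorderRankLimit
import Literature.Computability.AlgebraicComplexity.AlderStrassenProofs
import Literature.Computability.AlgebraicComplexity.BorderRankMatMulThreeWindow

/-!
# `FidelityWitnesses.FidelityGapThreeSeventeen` (stmt-MatrixMultiplication-4958) — Negative lane:
# the crux is exactly `18 ≤ R̲(⟨3,3,3⟩)`, and what a disproof must be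

Negative / support lemmas of the standing disprover (`Cruxes/FidelityGapThreeSeventeen/Disproof.lean`,
§1–§2), landed for import by ideators, planners and the line lead.  No Theses statement is asserted
positively here.

* `fidelityGapThreeSeventeen_false_of_mem_closure` — if `⟨3,3,3⟩` is a limit of rank-`≤ 17` tensors
  the crux fails (continuity: the strict fidelity inequality at `S = ⟨3,3,3⟩` is an open condition).
* `fidelityGapThreeSeventeen_false_of_algBorderRank_le` — **kill switch**, fact-free:
  `R̲(⟨3,3,3⟩) ≤ 17 → ¬ crux` (a border-rank-17 approximate algorithm for `3 × 3` matrices refutes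
  the crux; the best known has 20 multiplications, Smirnov 2013, kernel-checked in the tree).
* `eighteen_le_algBorderRank_of_fidelityGapThreeSeventeen` — the crux IMPLIES the open bound
  `18 ≤ R̲(⟨3,3,3⟩)` (so it is at least as hard as improving Conner–Harper–Landsberg's 17).
* `algBorderRank_le_seventeen_of_not_fidelityGapThreeSeventeen` — conversely a failure of the crux
  forces `R̲(⟨3,3,3⟩) ≤ 17` (cone criterion `stub_coneClosure` + Alder's theorem, tree theorems):
  there is no cheap counterexample — any disproof IS a border-rank-17 scheme.
* `fidelityGap_three_false_of_twenty_le` — the rank threshold is load-bearing: with `17` replaced by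
  any `r ≥ 20` the statement is false (Smirnov's scheme).
-/

namespace Summit.MatrixMultiplication.MatrixMultiplication.Theorems

open scoped BigOperators ComplexConjugate
open Literature.Computability.AlgebraicComplexity
open Summit.MatrixMultiplication.MatrixMultiplication.Theses.FidelityWitnesses (FidelityGapThreeSeventeen)

/-- `Σ_{abc} ⟨n,n,n⟩_{abc} = n³` over any commutative ring (the tensor has `n³` ones). [folklore] -/
theorem fidelityGapThree_sum_matMulTensor (K : Type) [CommRing K] (n : ℕ) :
    (∑ a : Fin n × Fin n, ∑ b : Fin n × Fin n, ∑ c : Fin n × Fin n,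
      matMulTensor K n n n a b c) = (n : K) ^ 3 := by
  have h1 : ∀ a b : Fin n × Fin n,
      (∑ c : Fin n × Fin n, matMulTensor K n n n a b c) = if a.1 = b.1 then 1 else 0 := by
    intro a b
    by_cases hab : a.1 = b.1
    · rw [if_pos hab, Finset.sum_eq_single (b.2, a.2)]
      · simp [matMulTensor, hab]
      · intro c _ hc
        simp only [matMulTensor]
        rw [if_neg]
        rintro ⟨-, h2, h3⟩
        exact hc (Prod.ext h2.symm h3.symm)
      · intro h
        exact absurd (Finset.mem_univ _) h
    · rw [if_neg hab]
      exact Finset.sum_eq_zero fun c _ => by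
        simp [matMulTensor, hab]
  have h2 : ∀ a : Fin n × Fin n, (∑ b : Fin n × Fin n, if a.1 = b.1 then (1 : K) else 0) = n := by
    intro a
    rw [Fintype.sum_prod_type, Finset.sum_comm]
    simp
  simp_rw [h1, h2]
  simp [Finset.sum_const, Finset.card_univ, Fintype.card_prod, Fintype.card_fin]
  ring

/-- `Σ ⟨3,3,3⟩·⟨3,3,3⟩ = 27` in `ℂ` (entries are `0/1`). [folklore] -/
theorem fidelityGapThree_overlap_self :
    (∑ a : Fin 3 × Fin 3, ∑ b : Fin 3 × Fin 3, ∑ c : Fin 3 × Fin 3,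
      matMulTensor ℂ 3 3 3 a b c * matMulTensor ℂ 3 3 3 a b c) = (27 : ℂ) := by
  have hTT : ∀ a b c : Fin 3 × Fin 3,
      matMulTensor ℂ 3 3 3 a b c * matMulTensor ℂ 3 3 3 a b c = matMulTensor ℂ 3 3 3 a b c := by
    intro a b c
    simp only [matMulTensor]
    split_ifs <;> simp
  simp_rw [hTT]
  rw [fidelityGapThree_sum_matMulTensor ℂ 3]
  norm_num

/-- `‖⟨3,3,3⟩‖² = 27`. [folklore] -/
theorem fidelityGapThree_normSq_matMulTensor_three :
    (∑ a : Fin 3 × Fin 3, ∑ b : Fin 3 × Fin 3, ∑ c : Fin 3 × Fin 3,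
      ‖matMulTensor ℂ 3 3 3 a b c‖ ^ 2) = (27 : ℝ) := by
  have hNN : ∀ a b c : Fin 3 × Fin 3,
      ‖matMulTensor ℂ 3 3 3 a b c‖ ^ 2 = matMulTensor ℝ 3 3 3 a b c := by
    intro a b c
    simp only [matMulTensor]
    split_ifs <;> simp
  simp_rw [hNN]
  rw [fidelityGapThree_sum_matMulTensor ℝ 3]
  norm_num

/-- Sesquilinear and bilinear overlaps with the real tensor `⟨3,3,3⟩` have the same norm.
[folklore] -/
theorem fidelityGapThree_norm_overlap_conj
    (S : (Fin 3 × Fin 3) → (Fin 3 × Fin 3) → (Fin 3 × Fin 3) → ℂ) :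
    ‖∑ a, ∑ b, ∑ c, (starRingEnd ℂ) (S a b c) * matMulTensor ℂ 3 3 3 a b c‖ =
      ‖∑ a, ∑ b, ∑ c, S a b c * matMulTensor ℂ 3 3 3 a b c‖ := by
  have hc : ∀ a b c : Fin 3 × Fin 3,
      (starRingEnd ℂ) (matMulTensor ℂ 3 3 3 a b c) = matMulTensor ℂ 3 3 3 a b c := by
    intro a b c
    unfold matMulTensor
    split_ifs <;> simp
  have h : (∑ a, ∑ b, ∑ c, (starRingEnd ℂ) (S a b c) * matMulTensor ℂ 3 3 3 a b c)
      = (starRingEnd ℂ) (∑ a, ∑ b, ∑ c, S a b c * matMulTensor ℂ 3 3 3 a b c) := by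
    simp only [map_sum, map_mul, hc]
  rw [h, Complex.norm_conj]

/-- **No gap at `(3, r)` if `⟨3,3,3⟩` is a limit of rank-`≤ r` tensors** (easy half of the witness
theorem; continuity of the fidelity functional at `S = ⟨3,3,3⟩`, where the strict inequality
`(1 − ε)·27·27 < 27²` holds). [folklore] -/
theorem fidelityGapThree_false_of_mem_closure {r : ℕ}
    (h : matMulTensor ℂ 3 3 3 ∈ closure
      {S : (Fin 3 × Fin 3) → (Fin 3 × Fin 3) → (Fin 3 × Fin 3) → ℂ | tensorRank S ≤ r}) :
    ¬ ∃ ε : ℝ, 0 < ε ∧ ∀ S : (Fin 3 × Fin 3) → (Fin 3 × Fin 3) → (Fin 3 × Fin 3) → ℂ,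
      tensorRank S ≤ r → ‖∑ a, ∑ b, ∑ c, S a b c * matMulTensor ℂ 3 3 3 a b c‖ ^ 2 ≤
        (1 - ε) * 27 * ∑ a, ∑ b, ∑ c, ‖S a b c‖ ^ 2 := by
  rintro ⟨ε, hε, hgap⟩
  set f : ((Fin 3 × Fin 3) → (Fin 3 × Fin 3) → (Fin 3 × Fin 3) → ℂ) → ℝ := fun S =>
    ‖∑ a, ∑ b, ∑ c, S a b c * matMulTensor ℂ 3 3 3 a b c‖ ^ 2 -
      (1 - ε) * 27 * ∑ a, ∑ b, ∑ c, ‖S a b c‖ ^ 2 with hf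
  have hcont : Continuous f := by
    simp only [hf]
    fun_prop
  have hopen : IsOpen (f ⁻¹' Set.Ioi 0) := hcont.isOpen_preimage _ isOpen_Ioi
  have hT : matMulTensor ℂ 3 3 3 ∈ f ⁻¹' Set.Ioi 0 := by
    simp only [Set.mem_preimage, Set.mem_Ioi, hf, fidelityGapThree_overlap_self,
      fidelityGapThree_normSq_matMulTensor_three]
    have : ‖(27 : ℂ)‖ = 27 := by
      rw [show (27 : ℂ) = ((27 : ℝ) : ℂ) by norm_num, Complex.norm_real]
      norm_num
    rw [this]
    nlinarith
  obtain ⟨S, hSU, hSC⟩ := mem_closure_iff.1 h _ hopen hT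
  have h1 := hgap S hSC
  simp only [Set.mem_preimage, Set.mem_Ioi, hf] at hSU
  linarith

/-- **The crux fails if `⟨3,3,3⟩` is a limit of rank-`≤ 17` tensors.** [folklore] -/
theorem fidelityGapThreeSeventeen_false_of_mem_closure
    (h : matMulTensor ℂ 3 3 3 ∈ closure
      {S : (Fin 3 × Fin 3) → (Fin 3 × Fin 3) → (Fin 3 × Fin 3) → ℂ | tensorRank S ≤ 17}) :
    ¬ FidelityGapThreeSeventeen :=
  fidelityGapThree_false_of_mem_closure h

/-- **Kill switch (fact-free)**: a border-rank bound `R̲(⟨3,3,3⟩) ≤ 17` — i.e. an approximate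
bilinear algorithm for `3 × 3` matrix multiplication with `17` multiplications — refutes the crux
(elementary inclusion `{R̲ ≤ r} ⊆ closure {R ≤ r}` of `BorderRankLimit` + continuity).  The best
known scheme has `20` (Smirnov 2013, `Smirnov2013_algBorderRank_matMulTensor_three_le`). [folklore] -/
theorem fidelityGapThreeSeventeen_false_of_algBorderRank_le
    (h : algBorderRank (matMulTensor ℂ 3 3 3) ≤ 17) : ¬ FidelityGapThreeSeventeen :=
  fidelityGapThree_false_of_mem_closure (mem_closure_setOf_tensorRank_le_of_algBorderRank_le h)

/-- **The rank threshold is load-bearing**: with `17` replaced by any `r ≥ 20` the fidelity-gap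
statement is FALSE (Smirnov's kernel-checked border-rank-20 scheme). [folklore] -/
theorem fidelityGapThree_false_of_twenty_le {r : ℕ} (hr : 20 ≤ r) :
    ¬ ∃ ε : ℝ, 0 < ε ∧ ∀ S : (Fin 3 × Fin 3) → (Fin 3 × Fin 3) → (Fin 3 × Fin 3) → ℂ,
      tensorRank S ≤ r → ‖∑ a, ∑ b, ∑ c, S a b c * matMulTensor ℂ 3 3 3 a b c‖ ^ 2 ≤
        (1 - ε) * 27 * ∑ a, ∑ b, ∑ c, ‖S a b c‖ ^ 2 :=
  fidelityGapThree_false_of_mem_closure (mem_closure_setOf_tensorRank_le_of_algBorderRank_le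
    ((Smirnov2013_algBorderRank_matMulTensor_three_le ℂ).trans hr))

/-- **A failure of the crux forces `R̲(⟨3,3,3⟩) ≤ 17`**: by the cone closure criterion
(`stub_coneClosure`, line `closure-transfer` of the sibling crux) near-perfect overlaps put `⟨3,3,3⟩`
in `closure {R ≤ 17}`, which by Alder's theorem (`alder_secantVariety_eq_setOf_algBorderRank_le_holds`)
and Zariski = Euclidean closure over `ℂ` is `{R̲ ≤ 17}`.  So there is no cheap counterexample: any
disproof of the crux is a border-rank-17 scheme for `3 × 3` matrices. [folklore] -/
theorem algBorderRank_le_seventeen_of_not_fidelityGapThreeSeventeen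
    (h : ¬ FidelityGapThreeSeventeen) : algBorderRank (matMulTensor ℂ 3 3 3) ≤ 17 := by
  rw [← mem_closure_setOf_tensorRank_le_iff alder_secantVariety_eq_setOf_algBorderRank_le_holds]
  unfold Summit.MatrixMultiplication.MatrixMultiplication.Theses.FidelityWitnesses.FidelityGapThreeSeventeen
    at h
  push Not at h
  refine stub_coneClosure _ (fun c S hS => ?_) _ fun ε hε => ?_
  · show tensorRank (c • S) ≤ 17
    exact (tensorRank_smul_le c S).trans hS
  · obtain ⟨S, hS, hlt⟩ := h ε hε
    refine ⟨S, hS, ?_⟩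
    rw [fidelityGapThree_norm_overlap_conj, fidelityGapThree_normSq_matMulTensor_three]
    have hcomm : (1 - ε) * (∑ a, ∑ b, ∑ c, ‖S a b c‖ ^ 2) * 27
        = (1 - ε) * 27 * ∑ a, ∑ b, ∑ c, ‖S a b c‖ ^ 2 := by ring
    rw [hcomm]
    exact hlt

/-- **The crux implies the open bound `18 ≤ R̲(⟨3,3,3⟩)`** (contrapositive of the kill switch;
printed window `[17, 20]`, Conner–Harper–Landsberg 2023 / Smirnov 2013). [folklore] -/
theorem eighteen_le_algBorderRank_of_fidelityGapThreeSeventeen (h : FidelityGapThreeSeventeen) :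
    18 ≤ algBorderRank (matMulTensor ℂ 3 3 3) := by
  by_contra hlt
  exact fidelityGapThreeSeventeen_false_of_algBorderRank_le (by omega) h

end Summit.MatrixMultiplication.MatrixMultiplication.Theorems
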